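import Mathlib
import HarnessLib
import Summits.ValiantsHypothesis.ValiantsHypothesis.Theorems.LacunarySymmetroidMatrixDescartesProductPlusOneRowTowerKCalculus

/-!
# LINE (A) `product_plus_one` — the K-nomial θ-tower: TWO-LETTER tails with no bottom letter (binomial rows on a pair `(d_i, d_j)`, `i, j ≥ 1`)

Companion of ✓ `…RowTowerKDefs` / `…RowTowerKCalculus`.  In the `d₀`-based tower a binomial row on a pair of NON-bottom letters has `A = 0` and a tail supported on
two indices `i ≠ j`; its rate is `λ_j − λ_i` and it obeys the same exact law as every binomial feature (the K = 3 case is ✓ `pair12_rowPsi3_law` /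
✓ `pair12_rowPsi1_eq` of `…ThetaShell` / `…OneBump`):

* `rowHK_pair`, `row_pair` — the tower sums for a tail supported on `{i, j}`;
* ★ `rowPsiK3_pair_law` — `A = 0`, row non-vanishing ⇒ `ψ₃ − (λ_j − λ_i)²ψ₁ = 6ψ₁²`;
* `rowPsiK1_pair_eq` — `ψ₁ = −(λ_j − λ_i)²·(B_i x^{λ_i})(B_j x^{λ_j})·u²`; signs `rowPsiK1_pair_pos` (POLE: `B_iB_j < 0`) / `rowPsiK1_pair_neg` (KNEE: `B_iB_j > 0`).

Honest framing: row calculus; nothing closes; `OneChangeFloorK3` / `WronskianBudgetK3` / 18050 / `MatrixDescartes` OPEN; `VP ≠ VNP` NOT proved.  No definitions.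
-/

set_option linter.dupNamespace false

namespace Summit.ValiantsHypothesis.ValiantsHypothesis.Theorems.LacunarySymmetroidMatrixDescartes

namespace ProductPlusOne

open Finset
open scoped BigOperators

variable {n : ℕ} (lam : Fin n → ℕ) (A : ℝ) (B : Fin n → ℝ)

/-- A tail supported on two indices `i ≠ j`: `H_k = λ_i^k B_i x^{λ_i} + λ_j^k B_j x^{λ_j}`. [this file's lemma] -/
theorem rowHK_pair (i j : Fin n) (hij : i ≠ j) (hB : ∀ l, l ≠ i → l ≠ j → B l = 0) (k : ℕ) (x : ℝ) :
    rowHK lam k B x = ((lam i : ℕ) : ℝ) ^ k * (B i * x ^ (lam i)) + ((lam j : ℕ) : ℝ) ^ k * (B j * x ^ (lam j)) := by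
  unfold rowHK
  rw [← Finset.add_sum_erase Finset.univ _ (Finset.mem_univ i)]
  have hj : j ∈ Finset.univ.erase i := Finset.mem_erase.2 ⟨hij.symm, Finset.mem_univ j⟩
  rw [Finset.sum_eq_single_of_mem j hj (fun l hl hlj => by
    rw [hB l (Finset.ne_of_mem_erase hl) hlj]; ring)]
  ring

/-- The stripped row with a two-letter tail: `A − Σ_l B_l x^{λ_l} = A − B_i x^{λ_i} − B_j x^{λ_j}`. [this file's lemma] -/
theorem row_pair (i j : Fin n) (hij : i ≠ j) (hB : ∀ l, l ≠ i → l ≠ j → B l = 0) (x : ℝ) :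
    A - ∑ l, B l * x ^ (lam l) = A - B i * x ^ (lam i) - B j * x ^ (lam j) := by
  rw [← Finset.add_sum_erase Finset.univ _ (Finset.mem_univ i)]
  have hj : j ∈ Finset.univ.erase i := Finset.mem_erase.2 ⟨hij.symm, Finset.mem_univ j⟩
  rw [Finset.sum_eq_single_of_mem j hj (fun l hl hlj => by
    rw [hB l (Finset.ne_of_mem_erase hl) hlj]; ring)]
  ring

/-- ★ **THE TWO-LETTER RATE LAW** (no bottom letter: `A = 0`): `ψ₃ − (λ_j − λ_i)²ψ₁ = 6ψ₁²` where the row does not vanish. [this file's theorem] -/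
theorem rowPsiK3_pair_law (i j : Fin n) (hij : i ≠ j) (hB : ∀ l, l ≠ i → l ≠ j → B l = 0) {x : ℝ}
    (hF : (0 : ℝ) - ∑ l, B l * x ^ (lam l) ≠ 0) :
    rowPsiK3 lam 0 B x - (((lam j : ℕ) : ℝ) - ((lam i : ℕ) : ℝ)) ^ 2 * rowPsiK1 lam 0 B x = 6 * rowPsiK1 lam 0 B x ^ 2 := by
  have hF2 : (0 : ℝ) - B i * x ^ (lam i) - B j * x ^ (lam j) ≠ 0 := by rwa [row_pair lam 0 B i j hij hB] at hF
  unfold rowPsiK3 rowPsiK1 rowUK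
  simp only [rowHK_pair lam B i j hij hB, row_pair lam 0 B i j hij hB]
  field_simp
  ring

/-- The two-letter closed form: `ψ₁ = −(λ_j − λ_i)²·(B_i x^{λ_i})(B_j x^{λ_j})·u²`. [this file's lemma] -/
theorem rowPsiK1_pair_eq (i j : Fin n) (hij : i ≠ j) (hB : ∀ l, l ≠ i → l ≠ j → B l = 0) {x : ℝ}
    (hF : (0 : ℝ) - ∑ l, B l * x ^ (lam l) ≠ 0) :
    rowPsiK1 lam 0 B x
      = -((((lam j : ℕ) : ℝ) - ((lam i : ℕ) : ℝ)) ^ 2) * ((B i * x ^ (lam i)) * (B j * x ^ (lam j))) * rowUK lam 0 B x ^ 2 := by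
  have hF2 : (0 : ℝ) - B i * x ^ (lam i) - B j * x ^ (lam j) ≠ 0 := by rwa [row_pair lam 0 B i j hij hB] at hF
  unfold rowPsiK1 rowUK
  simp only [rowHK_pair lam B i j hij hB, row_pair lam 0 B i j hij hB]
  field_simp
  ring

/-- A two-letter POLE (`B_iB_j < 0`, distinct rates) has `ψ₁ > 0` (`x > 0`). [this file's lemma] -/
theorem rowPsiK1_pair_pos (i j : Fin n) (hij : i ≠ j) (hB : ∀ l, l ≠ i → l ≠ j → B l = 0) {x : ℝ} (hx : 0 < x)
    (hrate : lam i ≠ lam j) (hBB : B i * B j < 0) (hF : (0 : ℝ) - ∑ l, B l * x ^ (lam l) ≠ 0) : 0 < rowPsiK1 lam 0 B x := by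
  rw [rowPsiK1_pair_eq lam B i j hij hB hF]
  have hU : rowUK lam 0 B x ≠ 0 := by unfold rowUK; exact inv_ne_zero hF
  have hU2 : 0 < rowUK lam 0 B x ^ 2 := by positivity
  have hne : (((lam j : ℕ) : ℝ) - ((lam i : ℕ) : ℝ)) ≠ 0 := by
    intro h
    apply hrate
    have : ((lam j : ℕ) : ℝ) = ((lam i : ℕ) : ℝ) := by linarith
    exact_mod_cast this.symm
  have hsq : 0 < (((lam j : ℕ) : ℝ) - ((lam i : ℕ) : ℝ)) ^ 2 := by positivity
  have hprod : (B i * x ^ (lam i)) * (B j * x ^ (lam j)) < 0 := by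
    have : (B i * x ^ (lam i)) * (B j * x ^ (lam j)) = (B i * B j) * (x ^ (lam i) * x ^ (lam j)) := by ring
    rw [this]; exact mul_neg_of_neg_of_pos hBB (by positivity)
  have : 0 < -((((lam j : ℕ) : ℝ) - ((lam i : ℕ) : ℝ)) ^ 2) * ((B i * x ^ (lam i)) * (B j * x ^ (lam j))) := by
    rw [neg_mul, ← mul_neg]; exact mul_pos hsq (by linarith)
  exact mul_pos this hU2

/-- A two-letter KNEE (`B_iB_j > 0`, distinct rates) has `ψ₁ < 0` (`x > 0`). [this file's lemma] -/
theorem rowPsiK1_pair_neg (i j : Fin n) (hij : i ≠ j) (hB : ∀ l, l ≠ i → l ≠ j → B l = 0) {x : ℝ} (hx : 0 < x)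
    (hrate : lam i ≠ lam j) (hBB : 0 < B i * B j) (hF : (0 : ℝ) - ∑ l, B l * x ^ (lam l) ≠ 0) : rowPsiK1 lam 0 B x < 0 := by
  rw [rowPsiK1_pair_eq lam B i j hij hB hF]
  have hU : rowUK lam 0 B x ≠ 0 := by unfold rowUK; exact inv_ne_zero hF
  have hU2 : 0 < rowUK lam 0 B x ^ 2 := by positivity
  have hne : (((lam j : ℕ) : ℝ) - ((lam i : ℕ) : ℝ)) ≠ 0 := by
    intro h
    apply hrate
    have : ((lam j : ℕ) : ℝ) = ((lam i : ℕ) : ℝ) := by linarith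
    exact_mod_cast this.symm
  have hsq : 0 < (((lam j : ℕ) : ℝ) - ((lam i : ℕ) : ℝ)) ^ 2 := by positivity
  have hprod : 0 < (B i * x ^ (lam i)) * (B j * x ^ (lam j)) := by
    have : (B i * x ^ (lam i)) * (B j * x ^ (lam j)) = (B i * B j) * (x ^ (lam i) * x ^ (lam j)) := by ring
    rw [this]; positivity
  have : -((((lam j : ℕ) : ℝ) - ((lam i : ℕ) : ℝ)) ^ 2) * ((B i * x ^ (lam i)) * (B j * x ^ (lam j))) < 0 := by
    rw [neg_mul]; exact neg_neg_of_pos (mul_pos hsq hprod)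
  exact mul_neg_of_neg_of_pos this hU2

end ProductPlusOne

end Summit.ValiantsHypothesis.ValiantsHypothesis.Theorems.LacunarySymmetroidMatrixDescartes
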